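import Literature.Barriers.ValiantsHypothesis.AlgebraicNaturalProofsKRSTIO
import HarnessLib

/-!
# KRST 2022 AS PRINTED — Kumar–Ramya–Saptharishi–Tengse, *If VNP is hard, then so are equations
# for it* (STACS 2022 = arXiv:2012.07056): the displayed Main Theorem checked clause by clause
# against the tree, its POINTWISE quantifier form proved, and the family-level reading
# "`VNP` has no efficiently constructible equations" proved (val-lit t21; source
# `paper:arxiv-2012.07056`, chunks p0001–p0010; bib `KumarRamyaSaptharishiTengse2022`)

Typed literature and bookkeeping; `VP ≠ VNP` is NOT proved and nothing here is progress on it.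
This is the CHECK file of the cell `val-lit` (row KRST2022-A): the tree already PROVES the Main
Theorem in its frame (`succinctHittingSetsFromVNP_of_permanentExpHard`, almost-everywhere form,
`AlgebraicNaturalProofsKRSTVNP.lean`; infinitely-often form `…KRSTIO.lean`; route item
`Summit.ValiantsHypothesis.ValiantsHypothesis.Theses.BarrierLever.KRST2022`, closed). What this file
adds is only what the print states and the tree did not: (1) the POINTWISE quantifier shape of the
displayed theorem ("for an `m` large enough, IF `Perm_m` is hard THEN at `n = m^{ε/4}` …"), from
which both tree forms follow; (2) the print's phrasing "every nonzero `P` that vanishes on all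
coefficient vectors … has super-polynomial size"; (3) the notion "a class has efficiently
constructible equations" (a FAMILY `{P_N} ∈ VP` of equations, Def. 3–4 with the concluding
paragraph of §3.5) and the abstract's headline as a theorem about it. No new named fact.

## The sources read (versions)

* arXiv:2012.07056v1 (13 Dec 2020; the only arXiv version; "Full Version" per the LIPIcs front
  matter) — held as `paper:arxiv-2012.07056` (TeX-derived 3000-character CHUNKS p0001–p0010; macro
  tokens `\VP`, `\VNP`, `\binom`, `\size`, `\Perm` are DROPPED by the extractor, ref-3 ruling R0),
  cross-read against the arXiv e-print TeX source (`main.tex`, read-only fetch) for every dropped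
  token: the conclusion of the displayed theorem is `\operatorname{size}(P) = N^{\omega(1)}`
  (`main.tex` l.162), NOT `deg · size`.
* STACS 2022, LIPIcs 219, Art. 44, doi:10.4230/LIPIcs.STACS.2022.44 (open access; text read):
  Theorem 2 there ends "… has size at least `2^{0.1 n^4 - 3n}`" (explicit constant in place of
  `N^{ω(1)}`); otherwise the same statements. Numbering: arXiv Thm 1 = STACS Thm 1; arXiv MainThm
  (unnumbered `restatable`) = STACS Thm 2; arXiv Defs 2–7 = STACS Defs 3–8; arXiv Lemma 8 = STACS
  Lemma 2.1; Observation 9, Claim 10, Observations 11–12 and §§1–4 carry the same numbers in both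
  (the "§5" of some cell notes does not exist; "Discussion and Open Problems" is §4 in both).
  Decl names below use the arXiv (held-key) numbering, per the cell's ruling.

## The displayed Main Theorem, clause by clause (arXiv p0003 L55–59 = `main.tex` l.158–163)

"Let `ε > 0` be a constant. Suppose, for an `m` large enough, we have that `Perm_m` requires
circuits of size `2^{m^ε}`. Then, for `n = m^{ε/4}`, any `d ≤ n` and `N = binom(n+d, n)`, we have
that every nonzero polynomial `P(x_1, …, x_N)` that vanishes on all coefficient vectors of
polynomials in `VNP_ℂ(n,d)` has `size(P) = N^{ω(1)}`." Remark (p0004 L1): "easily extends to any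
field of characteristic zero."

| clause (print) | this file / tree | verdict |
|---|---|---|
| `ε > 0` real, hardness `size(Perm_m) ≥ 2^{m^ε}` | `ε = 1/c`, `c : ℕ`; `m` with `n = ⌊m^{ε/4}⌋`, i.e. `n^{4c} ≤ m < (n+1)^{4c}`, and the WEAKER hypothesis `2^{n^4} ≤ L(per_m)` (`≤ 2^{m^ε}`); only `m < (n+1)^{4c}` is kept | faithful up to `ε ∈ {1/c}` (cofinal: hardness at `ε` gives hardness at every `1/c ≤ ε`) |
| "for an `m` large enough … Then for `n = m^{ε/4}`" (POINTWISE: hard at `m` ⟹ conclusion at that `n`) | `KRST2022_mainThm_pointwise` / `_asPrinted`: `∃ n₀ ∀ n ≥ n₀ ∀ m < (n+1)^{4c}, hard m → …` | NEW here (tree had a.e. ⟹ a.e. and i.o. ⟹ i.o.; both are corollaries) |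
| "any `d ≤ n`, `N = binom(n+d,n)`" | `d = n`, `N = binom(2n,n)` = `Nat.choose (2*n) n`, monomial set `degLEMonomials n` IN THIS FILE; EVERY `d ≤ n`, `N = binom(n+d,n)` = `(n + d).choose n`, monomial set `monomialsDegLE n d`, class `vnpSlice F n d (n^b)` in `KRST2022GeneralDegree.lean` (`KRST2022_mainThm_pointwise_degLE`, `KRST2022_mainThm_asPrinted_degLE`, uniform in `d ≤ n`; 2026-08-27) | faithful: the instance `d = n` here, the printed quantifier "any `d ≤ n`" there — the truncation `F^{≤ d}` of the printed proof ("by standard homogenisation arguments", p0008 L42–43) is `truncation_mem_vnpSlice` on `BoolSumTrunc.exists_boolSum_eq_truncation` (`Literature/Computability/AlgebraicComplexity/BooleanSumDegreeTruncation.lean`); the KI step is taken from this file's `d = n` engine by renaming a degree-`d` distinguisher into the `d = n` frame (`N_d ≤ N_n`) |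
| "`VNP_ℂ(n,d)`" = "`VNP ∩ 𝔽[x_{[n]}]^{≤ d}`" (Def. 3; a class of FAMILIES cut at one `n` — formally every polynomial is the `n`-th member of some `VNP` family, so the literal set is all of `𝔽[x]^{≤d}`; the proof uses ONE explicit family of `VNP`-size polynomial in `n`) | the exponent slice `SmallDefinable F n b` (KRST Def. 3 at size `n^b`, `…KRSTVNP.lean`), ONE `b` depending on `c` only | faithful (the only meaningful reading; ref-3 R1 "FAITHFUL-AS-INSTANCE") |
| "every nonzero `P(x_1..x_N)` that vanishes on all coefficient vectors" | `∀ P : MvPolynomial (degLEMonomials n) F, P ≠ 0 → (∀ f ∈ SmallDefinable F n b, eval (coeffVector _ f) P = 0) → …` | verbatim |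
| "`size(P) = N^{ω(1)}`" (arXiv) / "size at least `2^{0.1n^4-3n}`" (STACS) | `∀ a, … N^a < complexity P`, GIVEN `P.totalDegree ≤ N^a` | ERRATUM-LEVEL DRIFT OF THE PRINT, typed in corrected form: the displayed statement has NO degree hypothesis on `P`, but its proof does — Lemma 8 is Kabanets–Impagliazzo's Lemma 30, whose conclusion is "size polynomial in the degree of `g`" (KI 2003 §5) via Kaltofen's factor bound, so what is proved is a bound for `P` of degree `poly(N)`; the authors' own summary says exactly this: "form a hitting set for all `N`-variate polynomials (where `N = binom(n+d,d)`) of degree `poly(N)` that are computable by circuits of size `poly(N)`" (p0008 L67). A size-only bound for `P` of unbounded degree would need closure of small circuits under low-degree ROOTS of high-degree circuits (Bürgisser's factor conjecture) and is not established by the source; it is NOT typed (cell ruling: corrected form only; ref-3 R1). The STACS constant `2^{0.1n^4-3n}` inherits the schematic exponent `0.1` of Lemma 8 ("`s^{0.1}`", Kaltofen's exponent) and is not reproduced; the tree's engine has the explicit root-closure exponent `7` (`kiBound`). |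
| field `ℂ`, Remark "any field of characteristic zero" | `[Field F] [CharZero F]` | = Remark 1 |
| Def. 2 "size = number of nodes" (inputs included, fan-in unspecified) | `complexity` = number of fan-in-two gates (Bürgisser's `L`) | polynomially related; absorbed by `ε`/the exponents |

Hypothesis forms: almost-everywhere `PermanentExpHardWith F c m₀` (`2^j ≤ L(per_{j^c})`, `j ≥ m₀`)
gives the pointwise hypothesis at `j = n^4`, `m = n^{4c}`; the printed "infinitely often" reading
of the concluding paragraph (p0008 L68–69) is `PermanentExpHardIO F c` (`…KRSTIO.lean`).

## The other numbered statements — CITED, not restated (tree decls, all proved unless marked)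

* Thm 1 [CKRST20] (p0003 L27–45; the `VNP_ℚ`, coefficients-in-`{-1,0,1}` theorem of
  Chatterjee–Kumar–Ramya–Saptharishi–Tengse 2020 = their restatable `VNPboundedCoeff`, Thm 1.3 of
  arXiv:2004.14147; `N = binom(n + n^c, n)`): typed by the cell's CKRST file
  (`Literature/Barriers/ValiantsHypothesis/CKRST2020Equations.lean`, decls `CKRST2020_thm_1_*`),
  not here; the tree's toy instance of its SHAPE is `isSuccinctHittingSet_and_isNaturalProofRel`.
* Def. 2 (algebraic circuits, size; p0006 L19) — `Literature.Computability.AlgebraicComplexity.ArithCircuit`,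
  `complexity`. Def. 3 (`VP`, `VNP`, `VP(n,d)`, `VNP(n,d)`; p0006 L26–35) — `IsVPFamily`,
  `IsVNPFamily`, `VP`, `VNP` (`ValiantClasses.lean`); the slices `SmallCircuits F n b`,
  `SmallDefinable F n b`. Def. 4 (equation for `𝒞_{n,d}`; p0006 L39–43) — `IsNaturalProof M 𝒞 𝒟 P`
  with `𝒟 = Set.univ` (FSV Def. 1, `AlgebraicNaturalProofs.lean`); the FAMILY notion is
  `HasEfficientEquations` below. Def. 5 (HSG; p0006 L45) — `IsHittingSetGenerator`
  (`AlgebraicNaturalProofsGenerators.lean`). Def. 6 (succinct hitting sets [GKSS17, FSV18];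
  p0006 L51) — `IsSuccinctHittingSet`. Def. 7 (`(ℓ,m,n)`-designs; p0006 L59) —
  `Literature.Computability.MetaComplexity.IsNWDesign`, `krstDesign`, `isNWDesign_krstDesign`
  (`KRSTDesign.lean`).
* Lemma 8 (HSG from hardness [KI04]; p0006 L67–74) — `kiGenerator_isHittingSetGenerator`,
  `complexity_le_of_kiGenerator_annihilated` (`KabanetsImpagliazzoHardness.lean`; sizes AND the
  annihilator's degree enter, as in KI's Lemma 30).
* §3.1 `Mon_{r,n}` + Observation 9 (p0007 L16–30) — `KRSTSucc.monSel`, `selProd`,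
  `KRSTSucc.aeval_bsub_monSel` (`KRSTSuccinctness.lean`). §3.2 Claim 10 + `Sel_{n,b,p}` +
  Observation 11 (p0007 L37–66) — Lagrange indicators `natIndicatorAt`, `selPoly`, `eval_selPoly`,
  `complexity_selPoly_le` (`KRSTSelection.lean`). (Print's Claim 10 says the interpolant of degree
  "at most `b`" through `b` conditions is "unique"; unique is the one of degree `< b` — immaterial.)
  §3.3 Reed–Solomon designs + Observation 12 (p0007 L71–p0008 L10) — `krstDesign`,
  `isNWDesign_krstDesign`, `krstDesign_apply`, `KRSTSucc.aeval_bsub_permSel`. §3.4 the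
  `VNP`-succinct KI generator `F_{n,a,p}` (p0008 L12–30) — `KRSTSucc.witness`, `KRSTSucc.target`,
  `KRSTSucc.sum_aeval_witness`, `KRSTSucc.exists_boolSum_eq_target`, `krstSuccinctIn_smallDefinable`.
  §3.5 (p0008 L32–61) — `kiBound`, `kiBound_lt_two_pow`, `kiBound_lt_complexity_perPoly`,
  `isSuccinctHittingSet_of_permanent_hard`, `succinctHittingSetsFromVNP_of_permanentExpHard`,
  `not_exists_isNaturalProof_smallDefinable_of_permanentExpHard`; concluding paragraph (i.o.,
  p0008 L63–69) — `PermanentExpHardIO`, `succinctHittingSetsFromVNP_io_of_permanentExpHardIO`.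
* §4's remark "our proof crucially uses the fact that `VNP` is closed under exponential sums"
  (p0009 L7) — the kernel no-go for the `VP` transfer is `not_jointlySuccinct_of_plantsPermanentAt`
  (`AlgebraicNaturalProofsPlanting.lean`).

## §4 "Open Problems" (p0009 L12–25) — NOT declarations (open questions are not Literature
## facts); their one-line renderings in this vocabulary, for the route side

* OP1 "prove an analogue of MainThm for equations for `VP`" = the route item
  `Summit.ValiantsHypothesis.ValiantsHypothesis.Theses.BarrierLever.KRSTForVP` (stmt-18967), verbatim
  `(∃ c m₀, PermanentExpHardWith ℂ c m₀) → SuccinctHittingSetsForVP ℂ` (its body inlines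
  `PermanentExpHardWith`). CITED, not restated.
* OP2 "upper bounds on the complexity of equations for `VP` … even under reasonable complexity
  theoretic assumptions; a first step: formulas, algebraic branching programs or constant depth
  circuits": `HasEfficientEquations F (SmallCircuits F)`; first steps
  `HasEfficientEquations F (fun n b => {f | f.totalDegree ≤ n ∧ formulaComplexity f ≤ n ^ b})`,
  `… determinantalComplexity f ≤ n ^ b` (the class of route item `SuccinctHittingSetsForVBP`),
  `… productDepthCircuitSize Δ f ≤ n ^ b` for a fixed `Δ` (`CircuitDepth.lean`,
  `DeterminantalComplexity.lean`). By `not_succinctHittingSetsForVP_of_hasEfficientEquations` the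
  `VP` form denies FSV Question 6.
* OP3 "is it true that `VNP` does not have efficiently constructible equations if `VP ≠ VNP`, or if
  `Perm_n` requires circuits of size `n^{polylog(n)}`?":
  `VP F ≠ VNP F → ¬ HasEfficientEquations F (SmallDefinable F)` and
  `(∃ k n₀, 2 ≤ k ∧ ∀ n ≥ n₀, 2 ^ (Nat.log 2 n) ^ k ≤ complexity (perPoly (Fin n) F)) → ¬ HasEfficientEquations F (SmallDefinable F)`.

## References

* [KumarRamyaSaptharishiTengse2022] M. Kumar, C. Ramya, R. Saptharishi, A. Tengse, *If VNP is hard,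
  then so are equations for it*, STACS 2022, LIPIcs 219, 44:1–44:13 (arXiv:2012.07056v1), Thm 2 =
  MainThm, Remark, Defs 2–7, Lemma 8, §3.5, §4.
* [KabanetsImpagliazzo2003] V. Kabanets, R. Impagliazzo, STOC 2003 (Comput. Complexity 13, 2004),
  Lemma 30 (the degree of the annihilator in the bound).
* [ChatterjeeKumarRamyaSaptharishiTengse2020] P. Chatterjee et al., FOCS 2020 (arXiv:2004.14147),
  Thm 1.3 (= KRST's Thm 1).
* [ForbesShpilkaVolk2018] M. A. Forbes, A. Shpilka, B. L. Volk, Theory Comput. 14 (2018), Def. 1,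
  Thm. 4, Question 6.
-/

noncomputable section

namespace Literature.Barriers.ValiantsHypothesis

open Literature.Computability.AlgebraicComplexity Literature.Computability.MetaComplexity
  MvPolynomial

/-! ### "A class has efficiently constructible equations" (Defs. 3–4 with §3.5's concluding
paragraph) -/

section Equations

variable (F : Type*) [Field F]

/-- **A family of efficiently constructible equations for a graded class** (KRST Def. 4 "equation
for `𝒞_{n,d}`" = a nonzero `P_N` vanishing on the coefficient vectors of `𝒞_{n,d}`, at the FAMILY
level of §3.5's concluding paragraph: "for a family `{P_N}` to be a family of equations for a class
`𝒞`, we want that for all large enough `n`, the corresponding polynomial `P_N` should vanish on the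
coefficient vectors of all `n`-variate polynomials in `𝒞`", the family itself being in `VP` —
Def. 3: size and degree `≤ N^a` for all large `N`). For an exponent-graded class
`𝒞 n b ⊆ 𝔽[x_1..x_n]^{≤ n}` (`SmallCircuits F`, `SmallDefinable F`, …; regime `d = n`,
`N = binom(2n,n)`, as everywhere in this catalogue): ONE exponent `a` and ONE polynomial `P n` in the
`N` coefficient variables per `n`, nonzero and in `Distinguishers F n a` for all large `n`, which for
EVERY size exponent `b` vanishes on all of `𝒞 n b` for all large `n` (the threshold may depend on
`b`, as it depends on the member family in print; a threshold uniform in `b` would force `P n = 0`).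
[cite: KumarRamyaSaptharishiTengse2022, Def. 4 and §3.5 (concluding paragraph)]
locator: paper:arxiv-2012.07056 chunk p0006.txt:L39–43, p0008.txt:L64–69 -/
def HasEfficientEquations (𝒞 : (n : ℕ) → ℕ → Set (MvPolynomial (Fin n) F)) : Prop :=
  ∃ a : ℕ, ∃ P : (n : ℕ) → MvPolynomial (degLEMonomials n) F,
    (∃ n₁ : ℕ, ∀ n : ℕ, n₁ ≤ n → P n ≠ 0 ∧ P n ∈ Distinguishers F n a) ∧
      ∀ b : ℕ, ∃ n₀ : ℕ, ∀ n : ℕ, n₀ ≤ n →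
        ∀ f ∈ 𝒞 n b, eval (coeffVector (degLEMonomials n) f) (P n) = 0

variable {F}

/-- Equations for a class are equations for every (slice-wise) subclass: "a first step perhaps
would be … potentially simpler models" (§4). [cite: KumarRamyaSaptharishiTengse2022, §4 (Open Problems, second item)]
locator: paper:arxiv-2012.07056 chunk p0009.txt:L19–20 -/
theorem HasEfficientEquations.anti {𝒞 𝒞' : (n : ℕ) → ℕ → Set (MvPolynomial (Fin n) F)}
    (h : HasEfficientEquations F 𝒞) (hsub : ∀ n b, 𝒞' n b ⊆ 𝒞 n b) :
    HasEfficientEquations F 𝒞' := by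
  obtain ⟨a, P, hP, hvan⟩ := h
  refine ⟨a, P, hP, fun b => ?_⟩
  obtain ⟨n₀, hn₀⟩ := hvan b
  exact ⟨n₀, fun n hn f hf => hn₀ n hn f (hsub n b hf)⟩

/-- A family of efficient equations of level `a` makes the class fail, for EVERY exponent `b` and
all large `n`, to be a hitting set for `Distinguishers F n a` (FSV Thm. 4 direction, family form).
[cite: KumarRamyaSaptharishiTengse2022, §1.3 ("a lower bound for equations for a class of polynomials is equivalent to showing the existence of succinctly describable hitting sets for this class")]
locator: paper:arxiv-2012.07056 chunk p0004.txt:L13 -/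
theorem exists_not_isSuccinctHittingSet_of_hasEfficientEquations
    {𝒞 : (n : ℕ) → ℕ → Set (MvPolynomial (Fin n) F)} (h : HasEfficientEquations F 𝒞) :
    ∃ a : ℕ, ∀ b : ℕ, ∃ n₀ : ℕ, ∀ n : ℕ, n₀ ≤ n →
      ¬ IsSuccinctHittingSet (degLEMonomials n) (𝒞 n b) (Distinguishers F n a) := by
  obtain ⟨a, P, ⟨n₁, hP⟩, hvan⟩ := h
  refine ⟨a, fun b => ?_⟩
  obtain ⟨n₀, hn₀⟩ := hvan b
  refine ⟨max n₀ n₁, fun n hn hhit => ?_⟩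
  obtain ⟨hne, hmem⟩ := hP n ((le_max_right _ _).trans hn)
  obtain ⟨f, hf, hfne⟩ := hhit (P n) hmem hne
  exact hfne (hn₀ n ((le_max_left _ _).trans hn) f hf)

/-- In particular efficient equations for `VP` (all of `SmallCircuits F n b`, every `b`) deny FSV
Question 6 / GKSS's succinct hitting sets for `VP` (`SuccinctHittingSetsForVP F`): the dichotomy
behind §4's second item. [cite: KumarRamyaSaptharishiTengse2022, §1.1 and §4]
locator: paper:arxiv-2012.07056 chunk p0003.txt:L20, p0009.txt:L19 -/
theorem not_succinctHittingSetsForVP_of_hasEfficientEquations [Infinite F]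
    (h : HasEfficientEquations F (SmallCircuits F)) : ¬ SuccinctHittingSetsForVP F := by
  intro hyp
  obtain ⟨a, ha⟩ := exists_not_isSuccinctHittingSet_of_hasEfficientEquations h
  obtain ⟨b, n₀, hb⟩ := hyp a
  obtain ⟨n₁, hn₁⟩ := ha b
  exact hn₁ (max n₀ n₁) (le_max_right _ _) (hb _ (le_max_left _ _))

end Equations

/-! ### The Main Theorem in its printed (pointwise) quantifier shape -/

section MainTheorem

variable {F : Type*} [Field F] [CharZero F]

/-- Arithmetic for the block size: `(n+1)^{4c} ≤ n^{9c}` for `n ≥ 2` (so a permanent `per_m` with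
`m < (n+1)^{4c}` is a projection of the engine's block permanent `per_{n^{3c'}}`, `c' = 3c`).
[cite: KumarRamyaSaptharishiTengse2022, §3.5] locator: paper:arxiv-2012.07056 chunk p0008.txt:L37 -/
private theorem succ_pow_four_mul_le (c n : ℕ) (hn : 2 ≤ n) :
    (n + 1) ^ (4 * c) ≤ krstBlock (3 * c) n := by
  have h4 : (n + 1) ^ 4 ≤ n ^ 9 := by
    have h1 : n + 1 ≤ 2 * n := by omega
    have h2 : (n + 1) ^ 4 ≤ (2 * n) ^ 4 := Nat.pow_le_pow_left h1 4
    have h3 : (16 : ℕ) ≤ n ^ 5 := le_trans (by norm_num) (Nat.pow_le_pow_left hn 5)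
    calc (n + 1) ^ 4 ≤ (2 * n) ^ 4 := h2
      _ = 16 * n ^ 4 := by ring
      _ ≤ n ^ 5 * n ^ 4 := Nat.mul_le_mul_right _ h3
      _ = n ^ 9 := by rw [← pow_add]
  unfold krstBlock
  calc (n + 1) ^ (4 * c) = ((n + 1) ^ 4) ^ c := by rw [pow_mul]
    _ ≤ (n ^ 9) ^ c := Nat.pow_le_pow_left h4 c
    _ = n ^ (3 * (3 * c)) := by rw [← pow_mul]; ring_nf

/-- **KRST Main Theorem, POINTWISE form (the displayed quantifier shape), PROVED.** For every
`c` (`ε = 1/c`) there is ONE `VNP`-size exponent `b` such that for every distinguisher level `a`,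
for all large `n` and every `m < (n+1)^{4c}` (print: `n = m^{ε/4}`, i.e. `n = ⌊m^{ε/4}⌋`): IF
`2^{n^4} ≤ L(per_m)` (implied by the printed "`Perm_m` requires circuits of size `2^{m^ε}`", since
`m^ε ≥ n^4`) THEN the coefficient vectors of `SmallDefinable F n b` ("`VNP(n, n)`" at size `n^b`)
hit every nonzero distinguisher of size and degree `≤ N^a`, `N = binom(2n,n)`. Regime `d = n` of
the printed "any `d ≤ n`" (every `d ≤ n`: `KRST2022_mainThm_pointwise_degLE` in
`KRST2022GeneralDegree.lean`, proved from this statement); degree clause per the proof and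
p0008 L67 (module docstring: erratum note). Proof = the tree's §3.5 engine
`isSuccinctHittingSet_of_permanent_hard` at block exponent `3c` (`per_m` is a projection of
`per_{n^{9c}}`, `complexity_perPoly_mono`), `kiBound_lt_two_pow` (`kiBound < 2^{n^3} ≤ 2^{n^4}`) and
the proved `VNP`-succinctness `krstSuccinctIn_smallDefinable`. The tree's almost-everywhere
form (`succinctHittingSetsFromVNP_of_permanentExpHard`: `PermanentExpHardWith F c m₀` gives the
hypothesis here at `j = n^4`, `m = n^{4c}`, for `c ≥ 1`) and infinitely-often form (`…KRSTIO.lean`)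
are the two asymptotic readings of this pointwise statement.
[cite: KumarRamyaSaptharishiTengse2022, Thm MainThm (= STACS Thm 2) and §3.5]
locator: paper:arxiv-2012.07056 chunk p0003.txt:L55–59 (statement), p0008.txt:L36–59 (proof) -/
theorem KRST2022_mainThm_pointwise (c : ℕ) :
    ∃ b : ℕ, ∀ a : ℕ, ∃ n₀ : ℕ, ∀ n : ℕ, n₀ ≤ n → ∀ m : ℕ, m < (n + 1) ^ (4 * c) →
      2 ^ (n ^ 4) ≤ complexity (perPoly (Fin m) F) →
        IsSuccinctHittingSet (degLEMonomials n) (SmallDefinable F n b) (Distinguishers F n a) := by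
  obtain ⟨b, n₂, hsucc⟩ := krstSuccinctIn_smallDefinable (F := F) (3 * c)
  refine ⟨b, fun a => ?_⟩
  obtain ⟨n₁, hn₁⟩ := kiBound_lt_two_pow a (3 * c)
  refine ⟨max (max n₁ n₂) 2, fun n hn m hm hhard => ?_⟩
  have hn1 : n₁ ≤ n := ((le_max_left _ _).trans (le_max_left _ _)).trans hn
  have hn2 : n₂ ≤ n := ((le_max_right _ _).trans (le_max_left _ _)).trans hn
  have h2n : 2 ≤ n := (le_max_right _ _).trans hn
  -- the hard permanent is a projection of the engine's block permanent
  have hm' : m ≤ krstBlock (3 * c) n := (le_of_lt hm).trans (succ_pow_four_mul_le c n h2n)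
  have h34 : 2 ^ (n ^ 3) ≤ 2 ^ (n ^ 4) :=
    Nat.pow_le_pow_right (by norm_num) (Nat.pow_le_pow_right (by omega) (by norm_num))
  have hki : kiBound a (3 * c) n < complexity (perPoly (Fin (krstBlock (3 * c) n)) F) :=
    calc kiBound a (3 * c) n < 2 ^ (n ^ 3) := hn₁ n hn1
      _ ≤ 2 ^ (n ^ 4) := h34
      _ ≤ complexity (perPoly (Fin m) F) := hhard
      _ ≤ complexity (perPoly (Fin (krstBlock (3 * c) n)) F) := complexity_perPoly_mono F hm'
  exact isSuccinctHittingSet_of_permanent_hard (lt_krstPrime (3 * c) n)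
    (krstBlock_sq_le_krstPrime (3 * c) n) hki (hsucc n hn2)

/-- **KRST 2022 Main Theorem AS PRINTED (arXiv MainThm = STACS Thm 2; LOAD-BEARING decl of GAP
row N4), PROVED from the tree.** "Let `ε > 0` be a constant. Suppose, for an `m` large enough,
we have that `Perm_m` requires circuits of size `2^{m^ε}`. Then, for `n = m^{ε/4}`, any `d ≤ n` and
`N = binom(n+d, n)`, we have that every nonzero polynomial `P(x_1,…,x_N)` that vanishes on all
coefficient vectors of polynomials in `VNP_ℂ(n,d)` has `size(P) = N^{ω(1)}`" [STACS: "has size at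
least `2^{0.1n^4-3n}`"]; Remark: any field of characteristic zero. Typed: `ε = 1/c`; `m` with
`m < (n+1)^{4c}` (`n = ⌊m^{ε/4}⌋`) and the weaker hypothesis `2^{n^4} ≤ L(per_m)` (`m^ε ≥ n^4`);
`d = n`, `N = binom(2n,n)` (INSTANCE of "any `d ≤ n`"; the general `d ≤ n`, `N = binom(n+d,n)` form
is `KRST2022_mainThm_asPrinted_degLE` in `KRST2022GeneralDegree.lean`); "`VNP_ℂ(n,d)`" = the slice
`SmallDefinable F n b` for ONE exponent `b = b(c)` (KRST Def. 3); "`size(P) = N^{ω(1)}`" = for every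
`a`, eventually `N^a < complexity P`, for `P` of DEGREE `≤ N^a` — the degree clause is the one the
printed proof uses (Lemma 8 = KI Lemma 30 with Kaltofen) and the authors state in §3.5's
concluding paragraph, "all `N`-variate polynomials … of degree `poly(N)` that are computable by
circuits of size `poly(N)`" (p0008 L67); the displayed sentence omits it (erratum-level; a
size-only bound for unbounded-degree `P` is not established in print; ref-3 ruling R1). Macro
reconstruction (R0): the dropped token in chunk p0003 L59 is `\operatorname{size}(P)` per the
arXiv TeX source l.162. [cite: KumarRamyaSaptharishiTengse2022, Thm MainThm (= STACS Thm 2) with Remark and §3.5 concluding paragraph]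
locator: paper:arxiv-2012.07056 chunk p0003.txt:L55–59, p0004.txt:L1–2, p0008.txt:L67 -/
theorem KRST2022_mainThm_asPrinted (c : ℕ) :
    ∃ b : ℕ, ∀ a : ℕ, ∃ n₀ : ℕ, ∀ n : ℕ, n₀ ≤ n → ∀ m : ℕ, m < (n + 1) ^ (4 * c) →
      2 ^ (n ^ 4) ≤ complexity (perPoly (Fin m) F) →
        ∀ P : MvPolynomial (degLEMonomials n) F, P ≠ 0 →
          P.totalDegree ≤ (Nat.choose (2 * n) n) ^ a →
          (∀ f ∈ SmallDefinable F n b, eval (coeffVector (degLEMonomials n) f) P = 0) →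
            (Nat.choose (2 * n) n) ^ a < complexity P := by
  obtain ⟨b, hb⟩ := KRST2022_mainThm_pointwise (F := F) c
  refine ⟨b, fun a => ?_⟩
  obtain ⟨n₀, hn₀⟩ := hb a
  refine ⟨n₀, fun n hn m hm hhard P hP hdeg hvan => ?_⟩
  by_contra hsize
  have hmem : P ∈ Distinguishers F n a := ⟨not_lt.1 hsize, hdeg⟩
  obtain ⟨f, hf, hne⟩ := hn₀ n hn m hm hhard P hmem hP
  exact hne (hvan f hf)

end MainTheorem

/-! ### "`VNP` does not have efficiently computable equations" (abstract; §3.5 concluding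
paragraph) -/

section NoEquations

variable {F : Type*} [Field F] [CharZero F]

/-- **§3.5, "Concluding that VNP has no efficient equations" — PROVED:** "suppose the Permanent
family is `2^{m^ε}`-hard for a constant `ε > 0`, which means that `Perm_m` is `2^{m^ε}`-hard for
infinitely many `m`. Then … for any family `{P_N} ∈ VP`, we must have for infinitely many `n` that
`P_N(f_n) ≠ 0` for some `f_n ∈ VNP`, which then shows that `{P_N}` is not a family of equations
for `VNP`." With the i.o. hypothesis `PermanentExpHardIO F c` (`ε = 1/c`) and the family notion
`HasEfficientEquations`, via `succinctHittingSetsFromVNP_io_of_permanentExpHardIO`.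
[cite: KumarRamyaSaptharishiTengse2022, §3.5 (concluding paragraph)]
locator: paper:arxiv-2012.07056 chunk p0008.txt:L63–69 -/
theorem KRST2022_not_hasEfficientEquations_VNP_io {c : ℕ} (hper : PermanentExpHardIO F c) :
    ¬ HasEfficientEquations F (SmallDefinable F) := by
  intro h
  obtain ⟨b, hb⟩ := succinctHittingSetsFromVNP_io_of_permanentExpHardIO hper
  obtain ⟨a, ha⟩ := exists_not_isSuccinctHittingSet_of_hasEfficientEquations h
  obtain ⟨n₀, hn₀⟩ := ha b
  obtain ⟨n, hn, hhit⟩ := hb a n₀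
  exact hn₀ n hn hhit

/-- **The abstract's headline — PROVED:** "Assuming that the Permanent polynomial requires
algebraic circuits of exponential size [`PermanentExpHardWith F c m₀`], … the class VNP does not
have efficiently computable equations. In other words, any nonzero polynomial that vanishes on the
coefficient vectors of all polynomials in the class VNP requires algebraic circuits of
super-polynomial size" (family form; the level-wise form is `KRST2022_mainThm_asPrinted`).
[cite: KumarRamyaSaptharishiTengse2022, Abstract and Thm MainThm]
locator: paper:arxiv-2012.07056 chunk p0002.txt:L3–4 -/
theorem KRST2022_not_hasEfficientEquations_VNP {c m₀ : ℕ} (hper : PermanentExpHardWith F c m₀) :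
    ¬ HasEfficientEquations F (SmallDefinable F) :=
  KRST2022_not_hasEfficientEquations_VNP_io hper.io

end NoEquations

end Literature.Barriers.ValiantsHypothesis

end
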